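import Literature.Topology.FourManifolds.HomotopySpheresSumDimTwoLeaves
import Literature.Topology.FourManifolds.HCobordismTheoremProofs
import Literature.Topology.FourManifolds.SmoothPoincareHighDim
import HarnessLib

/-!
# `Θ₂ = 0`: discharge of the smooth Poincaré conjecture in dimension `2`

Proof file (sibling of `SmoothPoincareLowDim.lean`) discharging the named fact
`Literature.Topology.FourManifolds.nonemptyDiffeomorphSphere_two`: every Hausdorff, second
countable smooth surface (modelled on `ℝ²`, without boundary) homotopy equivalent to `𝕊²` is
diffeomorphic to `𝕊²` (Mathlib's `ContinuousMap.HomotopyEquiv.NonemptyDiffeomorphSphere M 2`),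
at every universe.

## Source and proof

M. Kervaire, J. Milnor, *Groups of homotopy spheres I*, Ann. of Math. (2) 77 (1963), §2, p. 507:
"it follows … that `Θₙ = 0` for `n < 3`" (from the classification of surfaces; the paper's
`Θ₁ = Θ₂ = 0`, p. 504). The tree proves the classification statement needed here by Morse
theory, along Matsumoto's proof of his Thm. 3.35 (Y. Matsumoto, *An introduction to Morse
theory* (2002)) and Milnor's *Lectures on the h-cobordism theorem* (1965):

1. Every closed connected surface carries a self-indexing Morse function with exactly one
   critical point of index `0` and one of index `2` — Milnor 1965, Thm. 8.1 in dimension `2`,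
   whose last leaf in the tree was Assertion 6 of the proof of the First Cancellation Theorem 5.4
   (`Cobordism.Milnor1965_cancellation_modelChart`), now the theorem
   `Cobordism.Milnor1965_cancellation_modelChart_holds` (`HCobordismTheoremProofs.lean`, from the
   level deformation `Cobordism.Milnor1965_cancellation_levelDeformation_holds`,
   `HCobordismLevelDeformationProof.lean`); whence `exists_isMorse_isSelfIndexing_of_modelChart`
   (`HomotopySpheresSumDimTwoLeaves.lean`).
2. On a simply connected closed surface such a function has no saddle
   (`criticalSetOfIndex_one_eq_empty_of_simplyConnected`, `HomotopyTwoSphereNoSaddle.lean`: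
   a saddle level would disconnect a regular level, contradicting simple connectivity).
3. A Morse function with exactly two critical points on a closed surface makes it a twisted
   sphere, hence diffeomorphic to `𝕊²` (smooth Reeb theorem, Matsumoto Thm. 1.16 / Milnor 1963
   Thm. 4.1: `IsMorse.nonempty_diffeomorph_sphere_two_of_ncard_criticalSet_eq_two`,
   `MorseTwoCriticalPoints.lean`, with Cerf's `Γ₂ = 0`, `CerfPropositionFour.lean`).

Steps 1–3 are assembled at universe `0` by `nonemptyDiffeomorphSphere_two_of_modelChart`
(`HomotopySpheresSumDimTwoLeaves.lean`, on top of `SmoothPoincareTwoMorse.lean`); the gluing of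
the two discs in step 3 forces the surface to live in `Type`. The lift to an arbitrary universe
is the tree's `nonemptyDiffeomorphSphere_of_univ_zero` (`SmoothPoincareHighDim.lean`: a second
countable Hausdorff space is small, the smooth structure is transported to `Shrink.{0} M` along
`Shrink.homeomorph`, and diffeomorphisms compose).

## Main statements

* `nonemptyDiffeomorphSphere_two_univ_zero : nonemptyDiffeomorphSphere_two.{0}`.
* `nonemptyDiffeomorphSphere_two_holds : nonemptyDiffeomorphSphere_two` (no hypotheses).

## References

* M. Kervaire, J. Milnor, *Groups of homotopy spheres I*, Ann. of Math. (2) 77 (1963), 504–537,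
  §1 p. 504 and §2 p. 507. [KervaireMilnorAnnals1963]
* J. Milnor, *Lectures on the h-cobordism theorem*, Princeton (1965), Thm. 5.4 (Assertion 6),
  Thm. 8.1. [MilnorHCobordism1965]
* Y. Matsumoto, *An introduction to Morse theory*, AMS (2002), Thm. 1.16, Thm. 3.35. [Matsumoto2001]
-/

noncomputable section

open scoped Manifold ContDiff
open ContinuousMap

universe u

namespace Literature.Topology.FourManifolds

/-- **`Θ₂ = 0` at universe `0`** (Kervaire–Milnor 1963, p. 507): the tree's Morse-theoretic
reduction `nonemptyDiffeomorphSphere_two_of_modelChart` fed with the discharged Assertion 6 of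
Milnor's Thm. 5.4, `Cobordism.Milnor1965_cancellation_modelChart_holds`.
[cite: KervaireMilnorAnnals1963, §2 p. 507] [cite: MilnorHCobordism1965, proof of Thm. 5.4, Assertion 6] -/
theorem nonemptyDiffeomorphSphere_two_univ_zero : nonemptyDiffeomorphSphere_two.{0} :=
  nonemptyDiffeomorphSphere_two_of_modelChart Cobordism.Milnor1965_cancellation_modelChart_holds

/-- **Discharge of the smooth Poincaré conjecture in dimension `2` (`Θ₂ = 0`)** (Kervaire–Milnor,
*Groups of homotopy spheres I* (1963), §2 p. 507: "`Θₙ = 0` for `n < 3`"; here from Milnor's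
Thm. 8.1 in dimension `2`, the absence of saddles on simply connected closed surfaces and the
smooth Reeb theorem, all theorems of the tree, lifted from universe `0` by
`nonemptyDiffeomorphSphere_of_univ_zero`, `SmoothPoincareHighDim.lean`). Every Hausdorff second
countable smooth surface `M ≃ₕ 𝕊²` is diffeomorphic to `𝕊²`. [cite: KervaireMilnorAnnals1963, §2 p. 507] [cite: MilnorHCobordism1965, Thm. 8.1 and proof of Thm. 5.4 (Assertion 6)] [cite: Matsumoto2001, Thm. 1.16 and Thm. 3.35] -/
theorem nonemptyDiffeomorphSphere_two_holds : nonemptyDiffeomorphSphere_two.{u} :=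
  fun M _ _ _ => nonemptyDiffeomorphSphere_of_univ_zero nonemptyDiffeomorphSphere_two_univ_zero M

end Literature.Topology.FourManifolds

end
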